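import Literature.NumberTheory.EllipticCurves.GreenbergVatsal2000.CharacterLValueCEulerFactorProofs
import Literature.NumberTheory.EllipticCurves.GreenbergVatsal2000.CharacterLambdaCertificateZeroProofs
import HarnessLib

/-!
# Greenberg–Vatsal's character values at the point `T = 0` (`k = 1`): the closed form
# `(Σ₀-Euler factors) · (1 − ω̃(ψ̄(p))) · B₁(ω̃ ∘ ψ̄)`, the TRIVIAL ZERO `ψ(p) = 1 ⇒ λ ≠ 0`, and the
# UNIT CRITERION `ψ(p) ≠ 1 ∧ unit Euler factors ∧ ‖B₁‖ = 1 ⇒ λ = 0` — for BOTH `L_{Σ₀}(C, T)` and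
# `L_{Σ₀}(D, T)` (THEOREMS about the tree's definitions; curve-free, fact-free)

HONEST FRAMING (cell `bsd-eis`, width seat `bsd-line-x2-p1-w3` gen 6 on crux 3 `MazurMCOnCellB` =
stmt-BirchSwinnertonDyer-19033, line `twistback` v4, LEAD `bsd-line-x2-p1` g9; programme D-0033).
Theorems only: no definition, no named fact, no `sorry`; nothing booked; no label / cell / stub / tier
moves; no summit statement, main conjecture or case of BSD is proved. A CHARACTER-LEVEL brick for the
LEAD's `λ`-formula road into the registered stub `stub_upperPartner` (∃-PARTNER): at a partner
`V = E ⊗ χ_K` of an X2b pair the LEAD (verdict g9 §4; HOME STATUS 2026-08-28 14:44Z/14:46Z, validated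
51/51) reads GV (16)/(28) as `λ_an(V) = λ(L_{Σ₀}(C)) + λ(L_{Σ₀}(D)) − Σ_ℓ δ_ℓ(V)`, `C`, `D` the
character `p`-adic `L`-functions of the odd unramified character `ψ` of `V` (`IsCharacterLFunctionC/D`,
`characterLValueC/D`), so the certificate `(μ_an, λ_an)(V) = (0, 1)` (p640749 §3(ii), p642512 §5)
hinges on `ord_T` of `L_{Σ₀}(C)`/`L_{Σ₀}(D) mod p`, read off the value at `k = 1` = `T = 0` (tree
certificates `order_toNat_eq_zero_/order_ne_zero_of_isCharacterLFunctionC/D`). We compute that value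
in closed form from the tree's definitions via the tree's period-change / prime-depletion lemmas
(`twistedBernoulli_mul_eq`, `twistedBernoulli_deplete_prime`, `characterLValueC_eq_prod_eulerFactor_mul`):
* `characterLValueD p ψ Σ₀ 1 = −2·(1 − ω̃(ψ(p)⁻¹))·B₁^{(d)}(ω̃∘ψ⁻¹)·∏_{v∈Σ₀}(1 − ω̃(ψ(ℓ_v))ℓ_v⁻¹)`,
  `B₁^{(d)}(θ) = twistedBernoulli p 1 d θ`, `ω̃ = teichmullerLift p` (Teichmüller lift, `0 ↦ 0`);
* `characterLValueC p φ Σ₀ 1 = ∏_{v∈Σ₀}(1 − χ₁(ℓ_v))·(−(1 − ω̃(χ(p)))·B₁^{(n)}(ω̃∘χ))` for ANY `χ`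
  mod `n` with `φ(a)·a⁻¹ = χ(a)` for `p ∤ a` (for GV's `φ = ωψ⁻¹`: `χ = ψ⁻¹` made imprimitive at
  the primes `≠ p` of `m`; `χ₁ = evenCharacterTwist p φ 1`).
The factor `1 − ω̃(ψ̄(p))` is the Euler factor at `p` of `L(0, ψ̄)`: the TRIVIAL ZERO of
`L_p(s, ωψ̄)` at `s = 0` when `ψ̄(p) = 1` (Washington Thm. 5.11 ff.; Lang Ch. 4 Thm. 3.2). Hence:
* TRIVIAL ZERO: `ψ(p) = 1` (resp. `χ(p) = 1`) ⇒ the value is `0` ⇒ `ord_T(g mod p) ≠ 0` for every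
  interpolating `g` (`order_ne_zero_of_isCharacterLFunctionD/C_of_apply_eq_one`). LEAD's reading for
  row A10 (HOME STATUS 14:46Z; not asserted here): at every partner of a SPLIT X2b cell `ψ(3) = +1`,
  so the `(0,1)`/`(0,2)` certificate roads meet this zero; at the 44 NON-split cells `ψ(3) = −1`.
* UNIT CRITERION: `p ≠ 2`, `ψ(p) ≠ 1`, `∀ v ∈ Σ₀: ℓ_v ≠ p ∧ ψ(ℓ_v) ≢ ℓ_v (mod p)` (resp.
  `χ(ℓ_v) ≠ 1`), `‖B₁(ω̃∘ψ⁻¹)‖ = 1` ⇒ `‖value‖ = 1` ⇒ `ord_T(g mod p) = 0`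
  (`order_toNat_eq_zero_of_isCharacterLFunctionD/C_of_units`). The Euler conditions are the LEAD's
  indicators `[ψ(ℓ)=1]` (`C`) / `[ψ(ℓ)≡ℓ]` (`D`) in `c(V)`; `‖B₁(ω̃∘χ_F)‖ = 1` is `p ∤ h_F` by the
  class-number formula `B_{1,χ_F} = −2h_F/w_F` (Washington Thm. 4.17) — NOT identified in this file.
References: [GreenbergVatsal2000] §3 pp. 41–42 ((26), (27)); [LangCyclotomic1990] Ch. 2 §2 (B 4,
B 7), Ch. 4 §3 Thm. 3.2; [Washington1997] Thms. 4.2, 4.17, 5.11; [Greenberg2001PastPresent] §4.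
-/

set_option autoImplicit false
set_option linter.dupNamespace false -- disclosed: the `…BirchSwinnertonDyer.BirchSwinnertonDyer…` namespace

noncomputable section

open scoped Classical

open Finset NumberField IsDedekindDomain Literature.NumberTheory.EllipticCurves
  Literature.NumberTheory.EllipticCurves.GreenbergVatsal2000

namespace Summit.BirchSwinnertonDyer.BirchSwinnertonDyer.Theorems.EisensteinPrimesMazurMCOnCellBTwistbackPartnerTrivialZero

variable (p : ℕ) [Fact p.Prime]

/-! ## §0. Units of `ℤ_p` read off residues -/

variable {p} in
/-- An element of `ℤ_p` with non-zero residue has `p`-adic norm `1` in `ℚ_p` (the tree's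
`isUnit_of_toZMod_ne_zero`: `ker (ℤ_p → 𝔽_p) = 𝔪`). [folklore] -/
theorem norm_coe_eq_one_of_toZMod_ne_zero {x : ℤ_[p]} (h : PadicInt.toZMod x ≠ 0) :
    ‖(x : ℚ_[p])‖ = 1 := by
  rw [← PadicInt.norm_def]
  exact PadicInt.isUnit_iff.mp (isUnit_of_toZMod_ne_zero h)

variable {p} in
/-- `‖1 − ω̃(c)‖ = 1` for a residue `c ≠ 1`: the residue of `1 − ω̃(c)` is `1 − c ≠ 0`
(`ω̃(c) ≡ c (mod p)`, Lang Ch. 1 §2). [cite: LangCyclotomic1990, Ch. 1 §2 (the Teichmüller character)] -/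
theorem norm_one_sub_teichmullerLift_eq_one {c : ZMod p} (hc : c ≠ 1) :
    ‖(1 : ℚ_[p]) - ((teichmullerLift p c : ℤ_[p]) : ℚ_[p])‖ = 1 := by
  rw [← PadicInt.coe_one, ← PadicInt.coe_sub]
  refine norm_coe_eq_one_of_toZMod_ne_zero ?_
  rw [map_sub, map_one, toZMod_teichmullerLift]
  exact sub_ne_zero.mpr (Ne.symm hc)

variable {p} in
/-- `‖ℓ − ω̃(c)‖ = 1` for a natural number `ℓ` and a residue `c ≠ ℓ (mod p)`: the residue of
`ℓ − ω̃(c)` is `ℓ − c ≠ 0`. [cite: LangCyclotomic1990, Ch. 1 §2 (the Teichmüller character)] -/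
theorem norm_natCast_sub_teichmullerLift_eq_one {ℓ : ℕ} {c : ZMod p} (hc : c ≠ (ℓ : ZMod p)) :
    ‖(ℓ : ℚ_[p]) - ((teichmullerLift p c : ℤ_[p]) : ℚ_[p])‖ = 1 := by
  rw [← PadicInt.coe_natCast, ← PadicInt.coe_sub]
  refine norm_coe_eq_one_of_toZMod_ne_zero ?_
  rw [map_sub, map_natCast, toZMod_teichmullerLift]
  exact sub_ne_zero.mpr (Ne.symm hc)

variable {p} in
/-- `‖ℓ‖_p = 1` for a prime `ℓ ≠ p`. [folklore] -/
theorem norm_natCast_eq_one_of_prime_ne {ℓ : ℕ} (hℓ : ℓ.Prime) (hne : ℓ ≠ p) :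
    ‖(ℓ : ℚ_[p])‖ = 1 := by
  rw [Padic.norm_natCast_eq_one_iff]
  exact (Nat.coprime_primes Fact.out hℓ).mpr (Ne.symm hne)

/-! ## §1. `L_{Σ₀}(D, T)` at `T = 0`: `−2·(1 − ω̃(ψ(p)⁻¹))·B₁^{(d)}(ω̃∘ψ⁻¹)·∏(1 − ω̃(ψ(ℓ))ℓ⁻¹)` -/

section D

variable {d : ℕ} [NeZero d] (ψ : DirichletCharacter (ZMod p) d)
  (S₀ : Finset (HeightOneSpectrum (𝓞 ℚ)))

omit [NeZero d] in
/-- At `k = 1` the twisted character `(ωψ⁻¹)ω^{−1} = ψ⁻¹` on integers prime to `p`: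
`oddCharacterTwist p ψ 1 = 1_{p ∤ ·} · ω̃(ψ(·)⁻¹)` (definitional unfolding, `(a⁻¹)⁰ = 1`).
[cite: GreenbergVatsal2000, §3 p. 42 (L_p(ωχ⁻¹ψ⁻¹, s) = ½ L(D, χ, κ(γ)^s − 1))] -/
theorem oddCharacterTwist_one_eq :
    oddCharacterTwist p ψ 1 = fun a : ℕ ↦
      if p ∣ a then 0 else teichmullerLift p (ψ (a : ZMod d))⁻¹ := by
  funext a
  unfold oddCharacterTwist
  simp only [Nat.sub_self, pow_zero, one_mul]

omit [NeZero d] in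
/-- `ω̃ ∘ ψ⁻¹` is `d`-periodic. [cite: LangCyclotomic1990, Ch. 2 §2, B 6–B 7 (characters extended by 0)] -/
theorem teichmullerLift_inv_apply_add (a : ℕ) :
    teichmullerLift p (ψ ((a + d : ℕ) : ZMod d))⁻¹ = teichmullerLift p (ψ (a : ZMod d))⁻¹ := by
  have h : ((a + d : ℕ) : ZMod d) = (a : ZMod d) := by
    rw [Nat.cast_add, ZMod.natCast_self, add_zero]
  rw [h]

omit [NeZero d] in
/-- `ω̃ ∘ ψ⁻¹` is completely multiplicative. [cite: LangCyclotomic1990, Ch. 1 §2 (ω multiplicative) and Ch. 2 §2 (B 6)] -/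
theorem teichmullerLift_inv_apply_mul (x y : ℕ) :
    teichmullerLift p (ψ ((x * y : ℕ) : ZMod d))⁻¹ =
      teichmullerLift p (ψ (x : ZMod d))⁻¹ * teichmullerLift p (ψ (y : ZMod d))⁻¹ := by
  rw [Nat.cast_mul, map_mul, mul_inv, teichmullerLift_mul]

/-- **The `p`-depletion at `k = 1`**: `B₁^{(dp)}(1_{p∤·}·ω̃∘ψ⁻¹) = (1 − ω̃(ψ(p)⁻¹)) · B₁^{(d)}(ω̃∘ψ⁻¹)`
— the Euler factor of `L(0, ψ⁻¹)` at `p` (Lang Ch. 2 §2 B 4/B 7 via the tree's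
`twistedBernoulli_deplete_prime`; Washington Thm. 5.11: the factor `(1 − χω^{−n}(p)p^{n−1})` at
`n = 1`). [cite: LangCyclotomic1990, Ch. 2 §2, B 4 and B 7 (PDF pp. 34–35)]
[cite: Washington1997, Thm. 5.11 (Euler factor at p of L_p(1−n, χ))] -/
theorem twistedBernoulli_oddCharacterTwist_one_eq :
    twistedBernoulli p 1 (d * p) (oddCharacterTwist p ψ 1) =
      (1 - ((teichmullerLift p (ψ (p : ZMod d))⁻¹ : ℤ_[p]) : ℚ_[p])) *
        twistedBernoulli p 1 d (fun a : ℕ ↦ teichmullerLift p (ψ (a : ZMod d))⁻¹) := by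
  rw [oddCharacterTwist_one_eq p ψ,
    twistedBernoulli_deplete_prime p le_rfl (NeZero.pos d) (Nat.Prime.pos Fact.out)
      (fun a : ℕ ↦ teichmullerLift p (ψ (a : ZMod d))⁻¹) (teichmullerLift_inv_apply_add p ψ)
      (fun b ↦ teichmullerLift_inv_apply_mul p ψ b p)]
  simp only [Nat.sub_self, pow_zero, mul_one]

/-- **`L_{Σ₀}(D, T)` at `T = 0` in closed form**: `characterLValueD p ψ Σ₀ 1 =
−2 · (1 − ω̃(ψ(p)⁻¹)) · B₁^{(d)}(ω̃ ∘ ψ⁻¹) · ∏_{v∈Σ₀} (1 − ω̃(ψ(ℓ_v)) · ℓ_v⁻¹)` — GV (27) at `k = 1`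
(`T = κ(γ)⁰ − 1 = 0`): `½ L(D, 0) = L_p(ωψ⁻¹, 0) = −(1 − ψ⁻¹(p)) B_{1,ψ⁻¹}` times the `Σ₀`-Euler
factors `1 − ψ(ℓ)ℓ⁻¹`. [cite: GreenbergVatsal2000, §3 p. 42 ((27) and the Σ₀-Euler factors 1 − χψ(l)l⁻¹(1+T)^{f_l})]
[cite: LangCyclotomic1990, Ch. 4 §3 Thm. 3.2 (L_p(1−k, χ) = −(1/k)B_{k,χω^{−k}})] -/
theorem characterLValueD_one_eq :
    characterLValueD p ψ S₀ 1 =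
      -2 * (1 - ((teichmullerLift p (ψ (p : ZMod d))⁻¹ : ℤ_[p]) : ℚ_[p])) *
        twistedBernoulli p 1 d (fun a : ℕ ↦ teichmullerLift p (ψ (a : ZMod d))⁻¹) *
        ∏ v ∈ S₀, (1 - ((teichmullerLift p (ψ (Rat.HeightOneSpectrum.natGenerator v : ZMod d)) :
            ℤ_[p]) : ℚ_[p]) * ((Rat.HeightOneSpectrum.natGenerator v : ℕ) : ℚ_[p])⁻¹) := by
  unfold characterLValueD
  rw [twistedBernoulli_oddCharacterTwist_one_eq p ψ]
  simp only [Nat.cast_one, div_one, Nat.sub_self, pow_zero, mul_one, pow_one]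
  ring

/-- **TRIVIAL ZERO of `L_{Σ₀}(D, T)` at `T = 0`**: if `ψ(p) = 1` then `characterLValueD p ψ Σ₀ 1 = 0`
(the Euler factor `1 − ψ⁻¹(p)` vanishes; Ferrero–Greenberg's trivial zero of `L_p(ωψ⁻¹, s)` at
`s = 0`). [cite: Washington1997, Thm. 5.11 and the remark following it (L_p(0, χ) has the factor 1 − χω⁻¹(p))]
[cite: GreenbergVatsal2000, §3 p. 42 (27)] -/
theorem characterLValueD_one_eq_zero_of_apply_eq_one (hψ : ψ (p : ZMod d) = 1) :
    characterLValueD p ψ S₀ 1 = 0 := by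
  rw [characterLValueD_one_eq p ψ S₀, hψ, inv_one, teichmullerLift_one]
  simp

/-- **`λ(L_{Σ₀}(D, T)) ≠ 0` in the trivial-zero case**: for every `g ∈ Λ` interpolating GV (27) and
`ψ(p) = 1`, `ord_T(g mod p) ≠ 0` (so `λ(g) ≥ 1` whenever `g` has unit content). Composition of the
tree certificate `order_ne_zero_of_isCharacterLFunctionD` with the vanishing of the value at `k = 1`.
[cite: Greenberg2001PastPresent, §4 pp. 355–356] [cite: GreenbergVatsal2000, §3 p. 42 (27)] -/
theorem order_ne_zero_of_isCharacterLFunctionD_of_apply_eq_one {g : IwasawaAlgebra p}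
    (hg : IsCharacterLFunctionD p ψ S₀ g) (hψ : ψ (p : ZMod d) = 1) :
    (PowerSeries.map (PadicInt.toZMod (p := p)) g).order ≠ 0 :=
  order_ne_zero_of_isCharacterLFunctionD p ψ S₀ hg
    (by rw [characterLValueD_one_eq_zero_of_apply_eq_one p ψ S₀ hψ, norm_zero]; exact one_pos)

/-- **UNIT CRITERION for `L_{Σ₀}(D, T)` at `T = 0`**: `p ≠ 2`, `ψ(p) ≠ 1` (no trivial zero), every
`ℓ_v` (`v ∈ Σ₀`) different from `p` with `ψ(ℓ_v) ≢ ℓ_v (mod p)` (unit Euler factor `1 − ψ(ℓ)ℓ⁻¹`),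
and `‖B₁^{(d)}(ω̃ ∘ ψ⁻¹)‖ = 1` ⟹ `‖characterLValueD p ψ Σ₀ 1‖ = 1`.
[cite: GreenbergVatsal2000, §3 p. 42 ((27) and the Σ₀-Euler factors)]
[cite: LangCyclotomic1990, Ch. 4 §3 Thm. 3.2] -/
theorem norm_characterLValueD_one_eq_one (hp : p ≠ 2) (hψ : ψ (p : ZMod d) ≠ 1)
    (hS : ∀ v ∈ S₀, Rat.HeightOneSpectrum.natGenerator v ≠ p ∧
      ψ (Rat.HeightOneSpectrum.natGenerator v : ZMod d) ≠
        ((Rat.HeightOneSpectrum.natGenerator v : ℕ) : ZMod p))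
    (hB : ‖twistedBernoulli p 1 d (fun a : ℕ ↦ teichmullerLift p (ψ (a : ZMod d))⁻¹)‖ = 1) :
    ‖characterLValueD p ψ S₀ 1‖ = 1 := by
  have h2 : ‖(2 : ℚ_[p])‖ = 1 := by
    simpa using (Padic.norm_natCast_eq_one_iff (p := p) (n := 2)).mpr
      ((Nat.coprime_primes Fact.out Nat.prime_two).mpr hp)
  rw [characterLValueD_one_eq p ψ S₀, norm_mul, norm_mul, norm_mul, norm_prod, hB, norm_neg, h2,
    norm_one_sub_teichmullerLift_eq_one (inv_ne_one.mpr hψ)]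
  rw [Finset.prod_eq_one]
  · simp
  intro v hv
  obtain ⟨hvp, hψv⟩ := hS v hv
  have hℓ : (Rat.HeightOneSpectrum.natGenerator v).Prime := Rat.HeightOneSpectrum.prime_natGenerator v
  have hℓ0 : ((Rat.HeightOneSpectrum.natGenerator v : ℕ) : ℚ_[p]) ≠ 0 := by
    exact_mod_cast hℓ.ne_zero
  have hfac : (1 - ((teichmullerLift p (ψ (Rat.HeightOneSpectrum.natGenerator v : ZMod d)) :
        ℤ_[p]) : ℚ_[p]) * ((Rat.HeightOneSpectrum.natGenerator v : ℕ) : ℚ_[p])⁻¹) =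
      ((Rat.HeightOneSpectrum.natGenerator v : ℕ) : ℚ_[p])⁻¹ *
        (((Rat.HeightOneSpectrum.natGenerator v : ℕ) : ℚ_[p]) -
          ((teichmullerLift p (ψ (Rat.HeightOneSpectrum.natGenerator v : ZMod d)) : ℤ_[p]) :
            ℚ_[p])) := by
    field_simp
  rw [hfac, norm_mul, norm_inv, norm_natCast_eq_one_of_prime_ne hℓ hvp, inv_one, one_mul,
    norm_natCast_sub_teichmullerLift_eq_one hψv]

/-- **`λ(L_{Σ₀}(D, T)) = 0` from the unit criterion**: under the hypotheses of
`norm_characterLValueD_one_eq_one`, every `g ∈ Λ` interpolating GV (27) has `ord_T(g mod p) = 0`.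
[cite: Greenberg2001PastPresent, §4 pp. 355–356] [cite: GreenbergVatsal2000, §3 p. 42 (27)] -/
theorem order_toNat_eq_zero_of_isCharacterLFunctionD_of_units {g : IwasawaAlgebra p}
    (hg : IsCharacterLFunctionD p ψ S₀ g) (hp : p ≠ 2) (hψ : ψ (p : ZMod d) ≠ 1)
    (hS : ∀ v ∈ S₀, Rat.HeightOneSpectrum.natGenerator v ≠ p ∧
      ψ (Rat.HeightOneSpectrum.natGenerator v : ZMod d) ≠
        ((Rat.HeightOneSpectrum.natGenerator v : ℕ) : ZMod p))
    (hB : ‖twistedBernoulli p 1 d (fun a : ℕ ↦ teichmullerLift p (ψ (a : ZMod d))⁻¹)‖ = 1) :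
    (PowerSeries.map (PadicInt.toZMod (p := p)) g).order.toNat = 0 :=
  order_toNat_eq_zero_of_isCharacterLFunctionD p ψ S₀ hg
    (norm_characterLValueD_one_eq_one p ψ S₀ hp hψ hS hB)

end D

/-! ## §2. `L_{Σ₀}(C, T)` at `T = 0`: `∏(1 − χ₁(ℓ)) · (−(1 − ω̃(χ(p))) · B₁^{(n)}(ω̃∘χ))` -/

section C

variable {m : ℕ} (φ : DirichletCharacter (ZMod p) m) (S₀ : Finset (HeightOneSpectrum (𝓞 ℚ)))
  {n : ℕ} [NeZero n] (χ : DirichletCharacter (ZMod p) n)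

/-- `χ₁ = φω^{−1}` is `mp`-periodic (a character modulo `m` times a function modulo `p`).
[cite: LangCyclotomic1990, Ch. 2 §2, B 6–B 7 (characters extended by 0)] -/
theorem evenCharacterTwist_add_mul (k a : ℕ) :
    evenCharacterTwist p φ k (a + m * p) = evenCharacterTwist p φ k a := by
  have h2 : (p ∣ a + m * p) ↔ p ∣ a := Nat.dvd_add_left (dvd_mul_left p m)
  have h3 : ((a + m * p : ℕ) : ZMod m) = a := by
    rw [Nat.cast_add, (ZMod.natCast_eq_zero_iff _ _).mpr (dvd_mul_right m p), add_zero]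
  have h4 : ((a + m * p : ℕ) : ZMod p) = a := by
    rw [Nat.cast_add, (ZMod.natCast_eq_zero_iff _ _).mpr (dvd_mul_left p m), add_zero]
  unfold evenCharacterTwist
  simp only [h2, h3, h4]

omit [NeZero n] in
/-- At `k = 1`, `χ₁(a) = ω̃(φ(a)·a⁻¹) = ω̃(χ(a))` off the multiples of `p` whenever `φ(a)·a⁻¹ = χ(a)`
there (for GV's `φ = ωψ⁻¹`: `χ = ψ⁻¹`, p. 41). [cite: GreenbergVatsal2000, §3 p. 41 (L_p(χωψ⁻¹, s) = L(C, χ, κ(γ)^{−s} − 1), ωψ⁻¹ = φ)] -/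
theorem evenCharacterTwist_one_eq
    (hχ : ∀ a : ℕ, ¬ p ∣ a → φ (a : ZMod m) * (a : ZMod p)⁻¹ = χ (a : ZMod n)) :
    evenCharacterTwist p φ 1 = fun a : ℕ ↦
      if p ∣ a then 0 else teichmullerLift p (χ (a : ZMod n)) := by
  funext a
  unfold evenCharacterTwist
  by_cases h : p ∣ a
  · rw [if_pos h, if_pos h]
  · rw [if_neg h, if_neg h, pow_one, hχ a h]

omit [NeZero n] in
/-- `ω̃ ∘ χ` is `n`-periodic. [cite: LangCyclotomic1990, Ch. 2 §2, B 6–B 7 (characters extended by 0)] -/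
theorem teichmullerLift_apply_add (a : ℕ) :
    teichmullerLift p (χ ((a + n : ℕ) : ZMod n)) = teichmullerLift p (χ (a : ZMod n)) := by
  have h : ((a + n : ℕ) : ZMod n) = (a : ZMod n) := by
    rw [Nat.cast_add, ZMod.natCast_self, add_zero]
  rw [h]

omit [NeZero n] in
/-- `ω̃ ∘ χ` is completely multiplicative. [cite: LangCyclotomic1990, Ch. 1 §2 (ω multiplicative) and Ch. 2 §2 (B 6)] -/
theorem teichmullerLift_apply_mul (x y : ℕ) :
    teichmullerLift p (χ ((x * y : ℕ) : ZMod n)) =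
      teichmullerLift p (χ (x : ZMod n)) * teichmullerLift p (χ (y : ZMod n)) := by
  rw [Nat.cast_mul, map_mul, teichmullerLift_mul]

/-- **The `p`-depletion at `k = 1` on the `C` side**: `B₁^{(mp)}(χ₁) = (1 − ω̃(χ(p))) · B₁^{(n)}(ω̃∘χ)`
(period change `mp ↝ nmp ↝ np` by the tree's `twistedBernoulli_mul_eq`, then
`twistedBernoulli_deplete_prime`). [cite: LangCyclotomic1990, Ch. 2 §2, B 4 and B 7 (PDF pp. 34–35)]
[cite: Washington1997, Thm. 5.11 (Euler factor at p of L_p(1−n, χ))] -/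
theorem twistedBernoulli_evenCharacterTwist_one_eq (hm : 0 < m)
    (hχ : ∀ a : ℕ, ¬ p ∣ a → φ (a : ZMod m) * (a : ZMod p)⁻¹ = χ (a : ZMod n)) :
    twistedBernoulli p 1 (m * p) (evenCharacterTwist p φ 1) =
      (1 - ((teichmullerLift p (χ (p : ZMod n)) : ℤ_[p]) : ℚ_[p])) *
        twistedBernoulli p 1 n (fun a : ℕ ↦ teichmullerLift p (χ (a : ZMod n))) := by
  have hp : 0 < p := Nat.Prime.pos Fact.out
  have hn : 0 < n := NeZero.pos n
  have hfe := evenCharacterTwist_one_eq p φ χ hχ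
  have hper_mp : ∀ a, evenCharacterTwist p φ 1 (a + m * p) = evenCharacterTwist p φ 1 a :=
    evenCharacterTwist_add_mul p φ 1
  have hper_np : ∀ a, evenCharacterTwist p φ 1 (a + n * p) = evenCharacterTwist p φ 1 a := by
    intro a
    rw [hfe]
    have h3 : ((a + n * p : ℕ) : ZMod n) = a := by
      rw [Nat.cast_add, (ZMod.natCast_eq_zero_iff _ _).mpr (dvd_mul_right n p), add_zero]
    simp only [Nat.dvd_add_left (dvd_mul_left p n), h3]
  calc twistedBernoulli p 1 (m * p) (evenCharacterTwist p φ 1)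
      = twistedBernoulli p 1 (n * (m * p)) (evenCharacterTwist p φ 1) :=
        (twistedBernoulli_mul_eq p le_rfl (Nat.mul_pos hm hp) hn _ hper_mp).symm
    _ = twistedBernoulli p 1 (m * (n * p)) (evenCharacterTwist p φ 1) := by
        rw [show n * (m * p) = m * (n * p) from by ring]
    _ = twistedBernoulli p 1 (n * p) (evenCharacterTwist p φ 1) :=
        twistedBernoulli_mul_eq p le_rfl (Nat.mul_pos hn hp) hm _ hper_np
    _ = (1 - ((teichmullerLift p (χ (p : ZMod n)) : ℤ_[p]) : ℚ_[p]) * (p : ℚ_[p]) ^ (1 - 1)) *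
          twistedBernoulli p 1 n (fun a : ℕ ↦ teichmullerLift p (χ (a : ZMod n))) := by
        rw [hfe]
        exact twistedBernoulli_deplete_prime p le_rfl hn hp _ (teichmullerLift_apply_add p χ)
          (fun b ↦ teichmullerLift_apply_mul p χ b p)
    _ = _ := by simp only [Nat.sub_self, pow_zero, mul_one]

/-- **`L_{Σ₀}(C, T)` at `T = 0` in closed form**: `characterLValueC p φ Σ₀ 1 =
∏_{v∈Σ₀} (1 − χ₁(ℓ_v)) · (−(1 − ω̃(χ(p))) · B₁^{(n)}(ω̃ ∘ χ))` — GV (26) at `k = 1` (`T = 0`):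
`L(C, 0) = L_p(φ, 0) = −(1 − χ(p)) B_{1,χ}` (`χ = φω⁻¹` on units) times the `Σ₀`-Euler factors
`1 − χ(ℓ)`. [cite: GreenbergVatsal2000, §3 pp. 41–42 ((26) and the Σ₀-Euler factors)]
[cite: LangCyclotomic1990, Ch. 4 §3 Thm. 3.2 (L_p(1−k, χ) = −(1/k)B_{k,χω^{−k}})] -/
theorem characterLValueC_one_eq (hm : 0 < m)
    (hχ : ∀ a : ℕ, ¬ p ∣ a → φ (a : ZMod m) * (a : ZMod p)⁻¹ = χ (a : ZMod n)) :
    characterLValueC p φ S₀ 1 =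
      (∏ v ∈ S₀, (1 - ((evenCharacterTwist p φ 1 (Rat.HeightOneSpectrum.natGenerator v) : ℤ_[p]) :
          ℚ_[p]))) *
        -((1 - ((teichmullerLift p (χ (p : ZMod n)) : ℤ_[p]) : ℚ_[p])) *
          twistedBernoulli p 1 n (fun a : ℕ ↦ teichmullerLift p (χ (a : ZMod n)))) := by
  rw [characterLValueC_eq_prod_eulerFactor_mul p φ S₀ le_rfl hm,
    twistedBernoulli_evenCharacterTwist_one_eq p φ χ hm hχ]
  simp only [Nat.cast_one, div_one, Nat.sub_self, pow_zero, mul_one, neg_mul, one_mul]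

/-- **TRIVIAL ZERO of `L_{Σ₀}(C, T)` at `T = 0`**: if `χ(p) = 1` (for GV: `ψ(p) = 1`) then
`characterLValueC p φ Σ₀ 1 = 0` (Ferrero–Greenberg's zero of `L_p(φ, s)` at `s = 0`).
[cite: Washington1997, Thm. 5.11 and the remark following it (L_p(0, χ) has the factor 1 − χω⁻¹(p))]
[cite: GreenbergVatsal2000, §3 p. 41 (26)] -/
theorem characterLValueC_one_eq_zero_of_apply_eq_one (hm : 0 < m)
    (hχ : ∀ a : ℕ, ¬ p ∣ a → φ (a : ZMod m) * (a : ZMod p)⁻¹ = χ (a : ZMod n))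
    (hχp : χ (p : ZMod n) = 1) :
    characterLValueC p φ S₀ 1 = 0 := by
  rw [characterLValueC_one_eq p φ S₀ χ hm hχ, hχp, teichmullerLift_one]
  simp

/-- **`λ(L_{Σ₀}(C, T)) ≠ 0` in the trivial-zero case**: for every `g ∈ Λ` interpolating GV (26)
and `χ(p) = 1`, `ord_T(g mod p) ≠ 0`. [cite: Greenberg2001PastPresent, §4 pp. 355–356]
[cite: GreenbergVatsal2000, §3 p. 41 (26)] -/
theorem order_ne_zero_of_isCharacterLFunctionC_of_apply_eq_one {g : IwasawaAlgebra p}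
    (hg : IsCharacterLFunctionC p φ S₀ g) (hm : 0 < m)
    (hχ : ∀ a : ℕ, ¬ p ∣ a → φ (a : ZMod m) * (a : ZMod p)⁻¹ = χ (a : ZMod n))
    (hχp : χ (p : ZMod n) = 1) :
    (PowerSeries.map (PadicInt.toZMod (p := p)) g).order ≠ 0 :=
  order_ne_zero_of_isCharacterLFunctionC p φ S₀ hg
    (by rw [characterLValueC_one_eq_zero_of_apply_eq_one p φ S₀ χ hm hχ hχp, norm_zero]
        exact one_pos)

/-- **UNIT CRITERION for `L_{Σ₀}(C, T)` at `T = 0`**: `χ(p) ≠ 1` (no trivial zero), every `ℓ_v`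
(`v ∈ Σ₀`) different from `p` with `χ(ℓ_v) ≠ 1` (unit Euler factor `1 − χ(ℓ)`), and
`‖B₁^{(n)}(ω̃ ∘ χ)‖ = 1` ⟹ `‖characterLValueC p φ Σ₀ 1‖ = 1`.
[cite: GreenbergVatsal2000, §3 pp. 41–42 ((26) and the Σ₀-Euler factors)]
[cite: LangCyclotomic1990, Ch. 4 §3 Thm. 3.2] -/
theorem norm_characterLValueC_one_eq_one (hm : 0 < m)
    (hχ : ∀ a : ℕ, ¬ p ∣ a → φ (a : ZMod m) * (a : ZMod p)⁻¹ = χ (a : ZMod n))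
    (hχp : χ (p : ZMod n) ≠ 1)
    (hS : ∀ v ∈ S₀, Rat.HeightOneSpectrum.natGenerator v ≠ p ∧
      χ (Rat.HeightOneSpectrum.natGenerator v : ZMod n) ≠ 1)
    (hB : ‖twistedBernoulli p 1 n (fun a : ℕ ↦ teichmullerLift p (χ (a : ZMod n)))‖ = 1) :
    ‖characterLValueC p φ S₀ 1‖ = 1 := by
  rw [characterLValueC_one_eq p φ S₀ χ hm hχ, norm_mul, norm_neg, norm_mul, norm_prod, hB,
    norm_one_sub_teichmullerLift_eq_one hχp, mul_one, mul_one]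
  refine Finset.prod_eq_one fun v hv ↦ ?_
  obtain ⟨hvp, hχv⟩ := hS v hv
  have hℓ : (Rat.HeightOneSpectrum.natGenerator v).Prime := Rat.HeightOneSpectrum.prime_natGenerator v
  have hnd : ¬ p ∣ Rat.HeightOneSpectrum.natGenerator v := fun h ↦
    hvp ((Nat.prime_dvd_prime_iff_eq Fact.out hℓ).mp h).symm
  rw [evenCharacterTwist_one_eq p φ χ hχ]
  simp only [hnd, if_false]
  exact norm_one_sub_teichmullerLift_eq_one hχv

/-- **`λ(L_{Σ₀}(C, T)) = 0` from the unit criterion**: under the hypotheses of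
`norm_characterLValueC_one_eq_one`, every `g ∈ Λ` interpolating GV (26) has `ord_T(g mod p) = 0`.
[cite: Greenberg2001PastPresent, §4 pp. 355–356] [cite: GreenbergVatsal2000, §3 p. 41 (26)] -/
theorem order_toNat_eq_zero_of_isCharacterLFunctionC_of_units {g : IwasawaAlgebra p}
    (hg : IsCharacterLFunctionC p φ S₀ g) (hm : 0 < m)
    (hχ : ∀ a : ℕ, ¬ p ∣ a → φ (a : ZMod m) * (a : ZMod p)⁻¹ = χ (a : ZMod n))
    (hχp : χ (p : ZMod n) ≠ 1)
    (hS : ∀ v ∈ S₀, Rat.HeightOneSpectrum.natGenerator v ≠ p ∧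
      χ (Rat.HeightOneSpectrum.natGenerator v : ZMod n) ≠ 1)
    (hB : ‖twistedBernoulli p 1 n (fun a : ℕ ↦ teichmullerLift p (χ (a : ZMod n)))‖ = 1) :
    (PowerSeries.map (PadicInt.toZMod (p := p)) g).order.toNat = 0 :=
  order_toNat_eq_zero_of_isCharacterLFunctionC p φ S₀ hg
    (norm_characterLValueC_one_eq_one p φ S₀ χ hm hχ hχp hS hB)

end C

end Summit.BirchSwinnertonDyer.BirchSwinnertonDyer.Theorems.EisensteinPrimesMazurMCOnCellBTwistbackPartnerTrivialZero

end
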